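import Literature.Probability.RandomPlanarGeometry.SAWPulledLargeForceExpansionZdIntegrality
import Literature.Probability.RandomPlanarGeometry.SAWPulledLargeForceExpansionZdSecondSymbol
import HarnessLib

/-!
# Pulled SAW on `ℤ^{d+1}` at large force: the integer symbol `S_k` of `c_k^{(d)} = S_k(2d)` is SIGNED-MONIC OF DEGREE `k − 1`

Topic `Literature/Probability/RandomPlanarGeometry` (continues `SAWPulledLargeForceExpansionZdIntegrality.lean`: `exists_int_polynomial_largeForceCoeffZd`,
`c_k^{(d)} = S_k(2d)` with `S_k ∈ ℤ[X]`, `deg ≤ k`, `S_k(0) = 0`; and a-p1's `SAWPulledLargeForceExpansionZdSecondSymbol.lean`: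
`exists_polynomial_largeForceCoeffZd_natDegree_eq`, `c_k^{(d)} = P_k(d)` with `P_k ∈ ℚ[X]` of degree EXACTLY `k − 1` and leading coefficient
`(−2)^{k−1}`, `k ≥ 2`).

PRINTED CONTEXT (locators only). Janse van Rensburg–Whittington (2013) §3.2 Theorem 8 (`c₁^{(d)} = 2d`); Madras–Slade (1993) §1.1 eq. (1.1.8) (the `1/d`
expansion); Graham (2010) §4 (integrality device). NOT IN PRINT (lane statement): the two interpolating polynomials are ONE polynomial (uniqueness of
interpolation on `ℕ`), so the integer symbol inherits the exact degree and the sign of the leading coefficient: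

* ★★★ `exists_int_polynomial_largeForceCoeffZd_monic` — for every `k ≥ 2`, **`c_k^{(d)} = S_k(2d)` with `S_k ∈ ℤ[X]`, `deg S_k = k − 1` EXACTLY,
  leading coefficient `(−1)^{k−1}`, `S_k(0) = 0`**: `c_k^{(d)} = (−1)^{k−1}(2d)^{k−1} + a_{k,k−2}(2d)^{k−2} + ⋯ + a_{k,1}·(2d)`, all `a_{k,j} ∈ ℤ`
  (`c₂ = −σ`, `c₃ = σ² + σ`, `c₄ = −σ³ − 3σ²`, `σ = 2d`);
* ★★ `coeff_eq_two_pow_mul_int_of_forall_largeForceCoeffZd_eq_eval` — ANY rational polynomial interpolating `d ↦ c_k^{(d)}` on `ℕ` (e.g. a-p1's) is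
  `S_k(2X)`: its `X^j`-coefficient is `2^j` times an integer.
[cite: JansevanRensburgWhittington2013, §3.2 Theorem 8 (arXiv v4 p. 11)] [cite: MadrasSlade1993, §1.1 eq. (1.1.8) p. 5] [cite: Graham2010, Section 4]

Provenance: lane «pcv-sawmu», a-p3 g25 (2026-08-28). PURE STD, no data, no definitions.
-/

noncomputable section

open Finset
open scoped BigOperators
open Literature.Probability.LatticeModels
open Literature.Probability.RandomPlanarGeometry.SAW

namespace Literature.Probability.RandomPlanarGeometry.SAW.Zd

/-! ## §6 The integer polynomial `S_k` is signed-monic of degree `k − 1` (combination with the second symbol) -/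

section Monic

/-- UNIQUENESS: an integer polynomial in `2d` and a rational polynomial in `d` that agree at every `d ∈ ℕ` are the same polynomial
(`S(2X) = P` in `ℚ[X]`). [folklore] -/
private theorem map_comp_two_mul_X_eq_of_eval_eq {S : Polynomial ℤ} {P : Polynomial ℚ}
    (h : ∀ d : ℕ, ((S.eval (2 * (d : ℤ)) : ℤ) : ℚ) = P.eval (d : ℚ)) :
    (S.map (Int.castRingHom ℚ)).comp (Polynomial.C 2 * Polynomial.X) = P := by
  apply Polynomial.eq_of_infinite_eval_eq
  refine (Set.infinite_range_of_injective Nat.cast_injective).mono ?_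
  rintro _ ⟨d, rfl⟩
  show Polynomial.eval (d : ℚ) ((S.map (Int.castRingHom ℚ)).comp (Polynomial.C 2 * Polynomial.X)) = Polynomial.eval (d : ℚ) P
  rw [← h d, Polynomial.eval_comp, Polynomial.eval_mul, Polynomial.eval_C, Polynomial.eval_X,
    show (2 * (d : ℚ)) = ((2 * (d : ℤ) : ℤ) : ℚ) by push_cast; ring, Polynomial.eval_intCast_map, Int.cast_id, eq_intCast]

/-- ★★★ **`S_k` IS SIGNED-MONIC OF DEGREE `k − 1`**: for every `k ≥ 2` there is `S_k ∈ ℤ[X]` with `deg S_k = k − 1` EXACTLY, leading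
coefficient `(−1)^{k−1}`, zero constant term, and `c_k^{(d)} = S_k(2d)` for every `d ∈ ℕ` — i.e.
`c_k^{(d)} = (−1)^{k−1}(2d)^{k−1} + a_{k,k−2}(2d)^{k−2} + ⋯ + a_{k,1}(2d)` with INTEGER `a_{k,j}` (`c₂ = −σ`, `c₃ = σ² + σ`, `c₄ = −σ³ − 3σ²`, …, `σ = 2d`).
Combines `exists_int_polynomial_largeForceCoeffZd` (integrality in `2d`, this lineage) with a-p1's second symbol
`exists_polynomial_largeForceCoeffZd_natDegree_eq` (degree `k − 1`, leading coefficient `(−2)^{k−1}` in `d`, over `ℚ`) through the uniqueness of the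
interpolating polynomial. [cite: JansevanRensburgWhittington2013, §3.2 Theorem 8 (arXiv v4 p. 11)] [cite: MadrasSlade1993, §1.1 eq. (1.1.8) p. 5] -/
theorem exists_int_polynomial_largeForceCoeffZd_monic {k : ℕ} (hk : 2 ≤ k) :
    ∃ S : Polynomial ℤ, S.natDegree = k - 1 ∧ S.leadingCoeff = (-1) ^ (k - 1) ∧ S.coeff 0 = 0 ∧
      ∀ d : ℕ, largeForceCoeffZd d k = S.eval (2 * (d : ℤ)) := by
  obtain ⟨S, -, hS0, hS⟩ := exists_int_polynomial_largeForceCoeffZd k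
  obtain ⟨P, hPdeg, hPlc, hP⟩ := exists_polynomial_largeForceCoeffZd_natDegree_eq hk
  have hcomp : (S.map (Int.castRingHom ℚ)).comp (Polynomial.C 2 * Polynomial.X) = P :=
    map_comp_two_mul_X_eq_of_eval_eq fun d => by rw [← hS d]; exact hP d
  have hinj : Function.Injective (Int.castRingHom ℚ) := Int.cast_injective
  have hq1 : (Polynomial.C (2 : ℚ) * Polynomial.X).natDegree = 1 := Polynomial.natDegree_C_mul_X 2 two_ne_zero
  have hdeg : S.natDegree = k - 1 := by
    have h1 := congrArg Polynomial.natDegree hcomp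
    rw [Polynomial.natDegree_comp, hq1, mul_one, Polynomial.natDegree_map_eq_of_injective hinj, hPdeg] at h1
    exact h1
  refine ⟨S, hdeg, ?_, hS0 (by omega), hS⟩
  have h2 := congrArg Polynomial.leadingCoeff hcomp
  rw [Polynomial.leadingCoeff_comp (by rw [hq1]; exact one_ne_zero), Polynomial.leadingCoeff_map_of_injective hinj,
    Polynomial.natDegree_map_eq_of_injective hinj, hdeg, Polynomial.leadingCoeff_C_mul_X, hPlc, eq_intCast] at h2
  -- `lc(S) · 2^{k−1} = (−2)^{k−1}` in `ℚ`
  have h3 : ((S.leadingCoeff : ℤ) : ℚ) * 2 ^ (k - 1) = ((-1) ^ (k - 1) : ℚ) * 2 ^ (k - 1) := by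
    rw [← mul_pow, neg_one_mul]; exact h2
  have h4 : ((S.leadingCoeff : ℤ) : ℚ) = (-1) ^ (k - 1) := mul_right_cancel₀ (pow_ne_zero _ two_ne_zero) h3
  exact_mod_cast h4

/-- ★★ THE RATIONAL SYMBOL HAS DYADIC-INTEGER COEFFICIENTS: if `Q ∈ ℚ[X]` interpolates `d ↦ c_k^{(d)}` on `ℕ` (e.g. the polynomial of
`exists_polynomial_largeForceCoeffZd`), then `Q = S_k(2X)`, so its coefficient of `X^j` is `2^j` times an INTEGER, for every `j`.
[cite: JansevanRensburgWhittington2013, §3.2 Theorem 8 (arXiv v4 p. 11)] [cite: Graham2010, Section 4] -/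
theorem coeff_eq_two_pow_mul_int_of_forall_largeForceCoeffZd_eq_eval (k : ℕ) {Q : Polynomial ℚ}
    (hQ : ∀ d : ℕ, (largeForceCoeffZd d k : ℚ) = Q.eval (d : ℚ)) (j : ℕ) : ∃ z : ℤ, Q.coeff j = 2 ^ j * (z : ℚ) := by
  obtain ⟨S, -, -, hS⟩ := exists_int_polynomial_largeForceCoeffZd k
  have hcomp : (S.map (Int.castRingHom ℚ)).comp (Polynomial.C 2 * Polynomial.X) = Q :=
    map_comp_two_mul_X_eq_of_eval_eq fun d => by rw [← hS d]; exact hQ d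
  refine ⟨S.coeff j, ?_⟩
  rw [← hcomp, Polynomial.comp, Polynomial.eval₂_eq_sum_range, Polynomial.finsetSum_coeff]
  rw [Finset.sum_eq_single j]
  · rw [mul_pow, ← Polynomial.C_pow, ← mul_assoc, ← Polynomial.C_mul, Polynomial.coeff_C_mul_X_pow, if_pos rfl,
      Polynomial.coeff_map, eq_intCast, mul_comm]
  · intro i _ hij
    rw [mul_pow, ← Polynomial.C_pow, ← mul_assoc, ← Polynomial.C_mul, Polynomial.coeff_C_mul_X_pow, if_neg (Ne.symm hij)]
  · intro hj
    have hj' : (S.map (Int.castRingHom ℚ)).natDegree < j := by simpa [Finset.mem_range] using hj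
    rw [Polynomial.coeff_eq_zero_of_natDegree_lt hj', Polynomial.C_0, zero_mul, Polynomial.coeff_zero]

end Monic

end Literature.Probability.RandomPlanarGeometry.SAW.Zd

end
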